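import Summits.QuantumFields.YangMills.Theorems.FluctuationComparisonRegPrIntLOrganTangentPullbackSquareLettersOn
import Summits.QuantumFields.YangMills.Theorems.FluctuationComparisonRegPrIntLOrganTangentTelescopeWindowPathShared
import HarnessLib

/-!
# Crux `FluctuationComparisonRegPrIntL` (stmt-QuantumFields-20520, rung R3), PATH-B organ, v18 (H-currency): BRICK 2a, ORGAN EDITION —
# THE PULL-BACK OF THE SEED H-CLAUSE ALONG A FIBRE TRANSPORT, POINTWISE IN THE FIBRE VARIABLE (LEAD's V18 LIN KNIT SPEC v1 §1 (iii) as one name; DEFINITION-FREE)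

Cell `ym3-torus` (YM ladder rung R3 = continuum `SU(2)` Yang–Mills on the three-torus — a RUNG: NOT d = 4, NOT infinite volume, NOT a mass gap, NOT Clay).
Width seat `ym3-torus-px19` (gen 19), helper on crux stmt-QuantumFields-20520 (`--kind proof --supports stmt-QuantumFields-20520 --as helper`, count-neutral,
no registry ∕ binder ∕ `Lines/` edit, default heartbeats, `autoImplicit false`).  Credit: BRICK 2a = LEAD `ym-ust-20520-w3` g25 (✓p805782); T2′ = px20 g17 (✓p807097).

WHAT THIS IS.  `V18-LIN-KNIT-SPEC-w3g25.md` v1 §1 step (iii): «channel 1 by 2a `secondDiff_pullback_letters` over T2′ `secondDiff_window_paths'` + GA», with §2's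
instantiation «`act := update-move on G_{Ts}`, `sz u := ‖u‖∕θ_f`, `actc := update-move on G_j`, `szc m := ‖m‖∕θ_c`, `T := fun V => Φ (V, z)` for each `z`».  THIS FILE is
that step as ONE theorem, pointwise in the fibre variable (so `T` is any map `GaugeField Pc jc SU(2) → GaugeField Pf jf SU(2)`):
★★`secondDiff_pullback_window` — INPUTS (all hypothesis-form): the fine pair clause `h` = the `HClauseSq θf rf k R` TEXT verbatim (the SEED clause at height `Ts`,
letters `k ≥ 0`); a windowed uniform-gradient row `hG : PlaqSmall θf U → ‖u‖∕θf ≤ rf → |R (update U b (U b * expPt u)) − R U| ≤ g b·(‖u‖∕θf)` (GA ✓p807878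
`firstDiff_update_of_analyticPairWindowAt`'s shape, `g b := Bρ∕rA` up to the knit's window∕cap conversion); transport data `T, E, Corr` with 2a's realisation identities
`hE`∕`hCorr` at the `update`-moves, column rows `hX`∕`hY` with letters `Xl`, `Yl`, and the per-square window hypotheses of 2a §2′ (base-path sizes `√3·(‖u‖∕θf) ≤ rf`, top ∕
correction sizes `≤ rf`, every grid and correction-prefix configuration `PlaqSmall θf`); OUTPUT: at the four `update`-corners of the coarse square `(V; B, m; B′, m′)`
`|R (T V₁₁) − R (T V₁₀) − R (T V₀₁) + R (T V₀₀)| ≤ (√3·Σ_{a c} Xl a B·k a c·Xl c B′ + Σ_d g d·Yl d B B′)·(‖m‖∕θc)·(‖m′‖∕θc)` — 2a §3's bracket at `C := √3` (RM-PB's row mass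
✓∕⧗`…OrganTangentPullbackRowMass.rowMass_pullback_letters_exp` applies by `exact`).  Proof = ✓∕⧗`…PullbackSquareLettersOn.secondDiff_pullback_letters_on` with
`hT2 := OrganTangentTelescopeWindowPathShared.secondDiff_window_paths' hθf hk h` (px20's T2′, the shared-bond bilinear telescope).  + `secondDiff_pullback_window_le`
(the same with any `kc ≥` the bracket).  §2 FIRST ORDER (spec §3 «channel-1-type bound holds pointwise in `z`», the CROSS channels' factor): ★`firstDiff_pullback_window`
`|R (T (V·m@B)) − R (T V)| ≤ (Σ_a g a·Xl a B)·(‖m‖∕θc)` from `hG` telescoped along `E V B m` (abstract `firstDiff_pullback_letters_on` = ✓2a `firstDiff_path_of_gradient_on` + `gradient_pathSum_le`, then the organ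
instance by plain application); + `_le`.

HONEST FRAMING: a composition of landed telescoping lemmas over HYPOTHESIS clauses; the transport `T`, its displacement paths `E`, `Corr` and letters `Xl`, `Yl` are NOT
constructed (print: [Balaban1985Variational] Thm 1 p.279 ∕ Prop 9 p.309 (190), [Balaban1984PropagatorsI] Prop 1.2 p.35 — LOCATE only); nothing of Bałaban's analysis is
asserted or proved; SPREAD-TRANSPORT-H ∕ FIBRE-LAW-H ∕ LINᵘ-H ∕ JENᵘ-H ∕ O1ᵘ-H v2 ∕ S1aᴴ ∕ 26243 ∕ S2α′ ∕ S2β OPEN; crux 20520 `FluctuationComparisonRegPrIntL` ∕ `YM3TorusSU2`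
NOT proved; no summit ∕ sub-problem statement is proved; rung R3 = SU(2) YM₃ on T³ at fixed lattice data — NOT d = 4, NOT infinite volume, NOT a mass gap, NOT Clay; the
Yang–Mills mass gap is NOT proved.  [folklore] bookkeeping.
-/

set_option autoImplicit false

noncomputable section

namespace Summit.QuantumFields.YangMills.Theorems.OrganTangentPullbackSquareOrgan

open scoped BigOperators
open Function
open Literature.MathematicalPhysics.QuantumFieldTheory.Balaban1983to89
open T4CubeChartExp (expPt)
open Summit.QuantumFields.YangMills.Theorems.OrganTangentPullbackSquareLettersOn (secondDiff_pullback_letters_on)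
open Summit.QuantumFields.YangMills.Theorems.OrganTangentTelescopeWindowPathShared (secondDiff_window_paths')

variable {Pf Pc : Params} {jf jc : ℕ} [DecidableEq (PBond Pf jf)] [DecidableEq (PBond Pc jc)]

/-- ★★ **THE ORGAN PULL-BACK, POINTWISE IN THE FIBRE VARIABLE** (LEAD V18 LIN KNIT SPEC v1 §1 (iii)): the seed pair clause `h` (the `HClauseSq θf rf k R` TEXT) and a
windowed uniform-gradient row `hG` for `R` on the fine window, pulled back along a transport `T` realised by displacement paths `E` (first order, column letters `Xl`)
and correction paths `Corr` (second order, letters `Yl`), bound the second difference of `R ∘ T` over a coarse `update`-square by 2a §3's bracket at `C := √3`. [folklore] -/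
theorem secondDiff_pullback_window {θf θc rf : ℝ} (hθf : 0 < θf)
    {k : PBond Pf jf → PBond Pf jf → ℝ} (hk : ∀ b b', 0 ≤ k b b')
    {R : GaugeField Pf jf (Matrix.specialUnitaryGroup (Fin 2) ℂ) → ℝ}
    (h : ∀ (b b' : PBond Pf jf) (v v' : Fin 3 → ℝ) (U V W Z : GaugeField Pf jf (Matrix.specialUnitaryGroup (Fin 2) ℂ)),
      ‖v‖ ≤ rf * θf → ‖v'‖ ≤ rf * θf → PlaqSmall θf U → PlaqSmall θf V → PlaqSmall θf W → PlaqSmall θf Z →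
      (∀ e, e ≠ b → V e = U e) → V b = U b * expPt v → (∀ e, e ≠ b' → W e = U e) → W b' = U b' * expPt v' →
      (∀ e, e ≠ b' → Z e = V e) → Z b' = V b' * expPt v' →
      |R Z - R V - R W + R U| ≤ k b b' * (‖v‖ / θf) * (‖v'‖ / θf))
    (g : PBond Pf jf → ℝ) (hg : ∀ d, 0 ≤ g d)
    (hG : ∀ (U : GaugeField Pf jf (Matrix.specialUnitaryGroup (Fin 2) ℂ)) (b : PBond Pf jf) (u : Fin 3 → ℝ),
      PlaqSmall θf U → ‖u‖ / θf ≤ rf → |R (update U b (U b * expPt u)) - R U| ≤ g b * (‖u‖ / θf))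
    (T : GaugeField Pc jc (Matrix.specialUnitaryGroup (Fin 2) ℂ) → GaugeField Pf jf (Matrix.specialUnitaryGroup (Fin 2) ℂ))
    (E : GaugeField Pc jc (Matrix.specialUnitaryGroup (Fin 2) ℂ) → PBond Pc jc → (Fin 3 → ℝ) → List (PBond Pf jf × (Fin 3 → ℝ)))
    (Corr : GaugeField Pc jc (Matrix.specialUnitaryGroup (Fin 2) ℂ) → PBond Pc jc → (Fin 3 → ℝ) → PBond Pc jc → (Fin 3 → ℝ) →
      List (PBond Pf jf × (Fin 3 → ℝ)))
    (Xl : PBond Pf jf → PBond Pc jc → ℝ) (Yl : PBond Pf jf → PBond Pc jc → PBond Pc jc → ℝ)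
    (hE : ∀ (V : GaugeField Pc jc (Matrix.specialUnitaryGroup (Fin 2) ℂ)) (B : PBond Pc jc) (m : Fin 3 → ℝ),
      (E V B m).foldl (fun U p => update U p.1 (U p.1 * expPt p.2)) (T V) = T (update V B (V B * expPt m)))
    (hCorr : ∀ (V : GaugeField Pc jc (Matrix.specialUnitaryGroup (Fin 2) ℂ)) (B : PBond Pc jc) (m : Fin 3 → ℝ) (B' : PBond Pc jc) (m' : Fin 3 → ℝ),
      (Corr V B m B' m').foldl (fun U p => update U p.1 (U p.1 * expPt p.2))
          ((E V B' m').foldl (fun U p => update U p.1 (U p.1 * expPt p.2)) ((E V B m).foldl (fun U p => update U p.1 (U p.1 * expPt p.2)) (T V))) =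
        T (update (update V B (V B * expPt m)) B' ((update V B (V B * expPt m)) B' * expPt m')))
    (hX : ∀ (V : GaugeField Pc jc (Matrix.specialUnitaryGroup (Fin 2) ℂ)) (B : PBond Pc jc) (m : Fin 3 → ℝ) (a₀ : PBond Pf jf),
      (((E V B m).filter (fun p => decide (p.1 = a₀))).map (fun p => ‖p.2‖ / θf)).sum ≤ Xl a₀ B * (‖m‖ / θc))
    (hY : ∀ (V : GaugeField Pc jc (Matrix.specialUnitaryGroup (Fin 2) ℂ)) (B : PBond Pc jc) (m : Fin 3 → ℝ) (B' : PBond Pc jc) (m' : Fin 3 → ℝ)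
      (d₀ : PBond Pf jf),
      (((Corr V B m B' m').filter (fun p => decide (p.1 = d₀))).map (fun p => ‖p.2‖ / θf)).sum ≤ Yl d₀ B B' * (‖m‖ / θc) * (‖m'‖ / θc))
    (V : GaugeField Pc jc (Matrix.specialUnitaryGroup (Fin 2) ℂ)) (B B' : PBond Pc jc) (m m' : Fin 3 → ℝ)
    (hszP : ∀ a ∈ E V B m, Real.sqrt 3 * (‖a.2‖ / θf) ≤ rf) (hszQ : ∀ c ∈ E V B' m', ‖c.2‖ / θf ≤ rf)
    (hszC : ∀ d ∈ Corr V B m B' m', ‖d.2‖ / θf ≤ rf)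
    (hgrid : ∀ i l, i ≤ (E V B m).length → l ≤ (E V B' m').length →
      PlaqSmall θf (((E V B' m').take l).foldl (fun U p => update U p.1 (U p.1 * expPt p.2))
        (((E V B m).take i).foldl (fun U p => update U p.1 (U p.1 * expPt p.2)) (T V))))
    (hcorr : ∀ i, i < (Corr V B m B' m').length →
      PlaqSmall θf (((Corr V B m B' m').take i).foldl (fun U p => update U p.1 (U p.1 * expPt p.2))
        ((E V B' m').foldl (fun U p => update U p.1 (U p.1 * expPt p.2)) ((E V B m).foldl (fun U p => update U p.1 (U p.1 * expPt p.2)) (T V))))) :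
    |R (T (update (update V B (V B * expPt m)) B' ((update V B (V B * expPt m)) B' * expPt m'))) - R (T (update V B (V B * expPt m)))
        - R (T (update V B' (V B' * expPt m'))) + R (T V)|
      ≤ (Real.sqrt 3 * ∑ a₀ : PBond Pf jf, ∑ c₀ : PBond Pf jf, Xl a₀ B * k a₀ c₀ * Xl c₀ B' + ∑ d₀ : PBond Pf jf, g d₀ * Yl d₀ B B')
        * (‖m‖ / θc) * (‖m'‖ / θc) :=
  secondDiff_pullback_letters_on (PlaqSmall θf) rf
    (fun (U : GaugeField Pf jf (Matrix.specialUnitaryGroup (Fin 2) ℂ)) (b : PBond Pf jf) (u : Fin 3 → ℝ) => update U b (U b * expPt u))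
    (fun u : Fin 3 → ℝ => ‖u‖ / θf) R k g (Real.sqrt 3) hk hg (fun u => div_nonneg (norm_nonneg u) hθf.le) (Real.sqrt_nonneg 3)
    (fun (V : GaugeField Pc jc (Matrix.specialUnitaryGroup (Fin 2) ℂ)) (B : PBond Pc jc) (m : Fin 3 → ℝ) => update V B (V B * expPt m))
    (fun m : Fin 3 → ℝ => ‖m‖ / θc) T E Corr Xl Yl
    (secondDiff_window_paths' hθf hk h) hG hE hCorr hX hY V B B' m m' hszP hszQ hszC hgrid hcorr

/-- The same with any coarse letters `kc ≥` the bracket (the shape a clause consumer quantifies). [folklore] -/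
theorem secondDiff_pullback_window_le {θf θc rf : ℝ} (hθf : 0 < θf) (hθc : 0 < θc)
    {k : PBond Pf jf → PBond Pf jf → ℝ} (hk : ∀ b b', 0 ≤ k b b')
    {R : GaugeField Pf jf (Matrix.specialUnitaryGroup (Fin 2) ℂ) → ℝ}
    (h : ∀ (b b' : PBond Pf jf) (v v' : Fin 3 → ℝ) (U V W Z : GaugeField Pf jf (Matrix.specialUnitaryGroup (Fin 2) ℂ)),
      ‖v‖ ≤ rf * θf → ‖v'‖ ≤ rf * θf → PlaqSmall θf U → PlaqSmall θf V → PlaqSmall θf W → PlaqSmall θf Z →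
      (∀ e, e ≠ b → V e = U e) → V b = U b * expPt v → (∀ e, e ≠ b' → W e = U e) → W b' = U b' * expPt v' →
      (∀ e, e ≠ b' → Z e = V e) → Z b' = V b' * expPt v' →
      |R Z - R V - R W + R U| ≤ k b b' * (‖v‖ / θf) * (‖v'‖ / θf))
    (g : PBond Pf jf → ℝ) (hg : ∀ d, 0 ≤ g d)
    (hG : ∀ (U : GaugeField Pf jf (Matrix.specialUnitaryGroup (Fin 2) ℂ)) (b : PBond Pf jf) (u : Fin 3 → ℝ),
      PlaqSmall θf U → ‖u‖ / θf ≤ rf → |R (update U b (U b * expPt u)) - R U| ≤ g b * (‖u‖ / θf))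
    (T : GaugeField Pc jc (Matrix.specialUnitaryGroup (Fin 2) ℂ) → GaugeField Pf jf (Matrix.specialUnitaryGroup (Fin 2) ℂ))
    (E : GaugeField Pc jc (Matrix.specialUnitaryGroup (Fin 2) ℂ) → PBond Pc jc → (Fin 3 → ℝ) → List (PBond Pf jf × (Fin 3 → ℝ)))
    (Corr : GaugeField Pc jc (Matrix.specialUnitaryGroup (Fin 2) ℂ) → PBond Pc jc → (Fin 3 → ℝ) → PBond Pc jc → (Fin 3 → ℝ) →
      List (PBond Pf jf × (Fin 3 → ℝ)))
    (Xl : PBond Pf jf → PBond Pc jc → ℝ) (Yl : PBond Pf jf → PBond Pc jc → PBond Pc jc → ℝ) (kc : PBond Pc jc → PBond Pc jc → ℝ)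
    (hkc : ∀ B B', Real.sqrt 3 * ∑ a₀ : PBond Pf jf, ∑ c₀ : PBond Pf jf, Xl a₀ B * k a₀ c₀ * Xl c₀ B' + ∑ d₀ : PBond Pf jf, g d₀ * Yl d₀ B B' ≤ kc B B')
    (hE : ∀ (V : GaugeField Pc jc (Matrix.specialUnitaryGroup (Fin 2) ℂ)) (B : PBond Pc jc) (m : Fin 3 → ℝ),
      (E V B m).foldl (fun U p => update U p.1 (U p.1 * expPt p.2)) (T V) = T (update V B (V B * expPt m)))
    (hCorr : ∀ (V : GaugeField Pc jc (Matrix.specialUnitaryGroup (Fin 2) ℂ)) (B : PBond Pc jc) (m : Fin 3 → ℝ) (B' : PBond Pc jc) (m' : Fin 3 → ℝ),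
      (Corr V B m B' m').foldl (fun U p => update U p.1 (U p.1 * expPt p.2))
          ((E V B' m').foldl (fun U p => update U p.1 (U p.1 * expPt p.2)) ((E V B m).foldl (fun U p => update U p.1 (U p.1 * expPt p.2)) (T V))) =
        T (update (update V B (V B * expPt m)) B' ((update V B (V B * expPt m)) B' * expPt m')))
    (hX : ∀ (V : GaugeField Pc jc (Matrix.specialUnitaryGroup (Fin 2) ℂ)) (B : PBond Pc jc) (m : Fin 3 → ℝ) (a₀ : PBond Pf jf),
      (((E V B m).filter (fun p => decide (p.1 = a₀))).map (fun p => ‖p.2‖ / θf)).sum ≤ Xl a₀ B * (‖m‖ / θc))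
    (hY : ∀ (V : GaugeField Pc jc (Matrix.specialUnitaryGroup (Fin 2) ℂ)) (B : PBond Pc jc) (m : Fin 3 → ℝ) (B' : PBond Pc jc) (m' : Fin 3 → ℝ)
      (d₀ : PBond Pf jf),
      (((Corr V B m B' m').filter (fun p => decide (p.1 = d₀))).map (fun p => ‖p.2‖ / θf)).sum ≤ Yl d₀ B B' * (‖m‖ / θc) * (‖m'‖ / θc))
    (V : GaugeField Pc jc (Matrix.specialUnitaryGroup (Fin 2) ℂ)) (B B' : PBond Pc jc) (m m' : Fin 3 → ℝ)
    (hszP : ∀ a ∈ E V B m, Real.sqrt 3 * (‖a.2‖ / θf) ≤ rf) (hszQ : ∀ c ∈ E V B' m', ‖c.2‖ / θf ≤ rf)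
    (hszC : ∀ d ∈ Corr V B m B' m', ‖d.2‖ / θf ≤ rf)
    (hgrid : ∀ i l, i ≤ (E V B m).length → l ≤ (E V B' m').length →
      PlaqSmall θf (((E V B' m').take l).foldl (fun U p => update U p.1 (U p.1 * expPt p.2))
        (((E V B m).take i).foldl (fun U p => update U p.1 (U p.1 * expPt p.2)) (T V))))
    (hcorr : ∀ i, i < (Corr V B m B' m').length →
      PlaqSmall θf (((Corr V B m B' m').take i).foldl (fun U p => update U p.1 (U p.1 * expPt p.2))
        ((E V B' m').foldl (fun U p => update U p.1 (U p.1 * expPt p.2)) ((E V B m).foldl (fun U p => update U p.1 (U p.1 * expPt p.2)) (T V))))) :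
    |R (T (update (update V B (V B * expPt m)) B' ((update V B (V B * expPt m)) B' * expPt m'))) - R (T (update V B (V B * expPt m)))
        - R (T (update V B' (V B' * expPt m'))) + R (T V)| ≤ kc B B' * (‖m‖ / θc) * (‖m'‖ / θc) := by
  have hmain := secondDiff_pullback_window hθf hk h g hg hG T E Corr Xl Yl hE hCorr hX hY V B B' m m' hszP hszQ hszC hgrid hcorr
  refine hmain.trans ?_
  have hmm : 0 ≤ (‖m‖ / θc) * (‖m'‖ / θc) := mul_nonneg (div_nonneg (norm_nonneg m) hθc.le) (div_nonneg (norm_nonneg m') hθc.le)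
  calc (Real.sqrt 3 * ∑ a₀ : PBond Pf jf, ∑ c₀ : PBond Pf jf, Xl a₀ B * k a₀ c₀ * Xl c₀ B' + ∑ d₀ : PBond Pf jf, g d₀ * Yl d₀ B B')
        * (‖m‖ / θc) * (‖m'‖ / θc)
      = (Real.sqrt 3 * ∑ a₀ : PBond Pf jf, ∑ c₀ : PBond Pf jf, Xl a₀ B * k a₀ c₀ * Xl c₀ B' + ∑ d₀ : PBond Pf jf, g d₀ * Yl d₀ B B')
        * ((‖m‖ / θc) * (‖m'‖ / θc)) := by ring
    _ ≤ kc B B' * ((‖m‖ / θc) * (‖m'‖ / θc)) := mul_le_mul_of_nonneg_right (hkc B B') hmm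
    _ = kc B B' * (‖m‖ / θc) * (‖m'‖ / θc) := by ring

/-! ## §2 First order: the pull-back of the windowed gradient row along the displacement path (the CROSS channels' pointwise factor) -/

section AbstractFirstOrder

open Summit.QuantumFields.YangMills.Theorems.OrganTangentPullbackSquare (firstDiff_path_of_gradient_on gradient_pathSum_le)

variable {X ι M Xc ιc Mc : Type*}

/-- ABSTRACT FIRST-ORDER PULL-BACK WITH COLUMN LETTERS (2a's setting): the windowed gradient row telescoped along the displacement path `E V B m`
(✓2a §1 `firstDiff_path_of_gradient_on`) and regrouped by bond (✓2a §3 `gradient_pathSum_le`): `|f (T (V·m@B)) − f (T V)| ≤ (Σ_{a₀} g a₀·Xl a₀ B)·szc m`. [folklore] -/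
theorem firstDiff_pullback_letters_on [Fintype ι] [DecidableEq ι]
    (Good : X → Prop) (ρ : ℝ) (act : X → ι → M → X) (sz : M → ℝ) (f : X → ℝ) (g : ι → ℝ) (hg : ∀ d, 0 ≤ g d)
    (actc : Xc → ιc → Mc → Xc) (szc : Mc → ℝ) (T : Xc → X) (E : Xc → ιc → Mc → List (ι × M)) (Xl : ι → ιc → ℝ)
    (hG : ∀ (Y : X) (b : ι) (n : M), Good Y → sz n ≤ ρ → |f (act Y b n) - f Y| ≤ g b * sz n)
    (hE : ∀ (V : Xc) (B : ιc) (m : Mc), (E V B m).foldl (fun V p => act V p.1 p.2) (T V) = T (actc V B m))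
    (hX : ∀ (V : Xc) (B : ιc) (m : Mc) (a₀ : ι),
      (((E V B m).filter (fun p => decide (p.1 = a₀))).map (fun p => sz p.2)).sum ≤ Xl a₀ B * szc m)
    (V : Xc) (B : ιc) (m : Mc) (hszE : ∀ a ∈ E V B m, sz a.2 ≤ ρ)
    (hpre : ∀ i, i < (E V B m).length → Good (((E V B m).take i).foldl (fun V p => act V p.1 p.2) (T V))) :
    |f (T (actc V B m)) - f (T V)| ≤ (∑ a₀ : ι, g a₀ * Xl a₀ B) * szc m := by
  have h1 := firstDiff_path_of_gradient_on Good ρ act sz f g hG (E V B m) (T V) hpre hszE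
  rw [hE V B m] at h1
  have h2 := gradient_pathSum_le sz g hg (E V B m) (fun a₀ => Xl a₀ B * szc m) (hX V B m)
  refine h1.trans (h2.trans_eq ?_)
  rw [Finset.sum_mul]
  exact Finset.sum_congr rfl (fun a₀ _ => by ring)

end AbstractFirstOrder

/-- ★ **FIRST-ORDER ORGAN PULL-BACK, POINTWISE IN THE FIBRE VARIABLE** (LEAD V18 LIN KNIT SPEC v1 §3 «channel-1-type bound holds pointwise in `z`»): the windowed
uniform-gradient row `hG`, telescoped along the displacement path `E V B m` and regrouped by bond with the column letters `Xl`: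
`|R (T (V·m@B)) − R (T V)| ≤ (Σ_a g a·Xl a B)·(‖m‖∕θc)`. [folklore] -/
theorem firstDiff_pullback_window {θf θc rf : ℝ}
    {R : GaugeField Pf jf (Matrix.specialUnitaryGroup (Fin 2) ℂ) → ℝ}
    (g : PBond Pf jf → ℝ) (hg : ∀ d, 0 ≤ g d)
    (hG : ∀ (U : GaugeField Pf jf (Matrix.specialUnitaryGroup (Fin 2) ℂ)) (b : PBond Pf jf) (u : Fin 3 → ℝ),
      PlaqSmall θf U → ‖u‖ / θf ≤ rf → |R (update U b (U b * expPt u)) - R U| ≤ g b * (‖u‖ / θf))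
    (T : GaugeField Pc jc (Matrix.specialUnitaryGroup (Fin 2) ℂ) → GaugeField Pf jf (Matrix.specialUnitaryGroup (Fin 2) ℂ))
    (E : GaugeField Pc jc (Matrix.specialUnitaryGroup (Fin 2) ℂ) → PBond Pc jc → (Fin 3 → ℝ) → List (PBond Pf jf × (Fin 3 → ℝ)))
    (Xl : PBond Pf jf → PBond Pc jc → ℝ)
    (hE : ∀ (V : GaugeField Pc jc (Matrix.specialUnitaryGroup (Fin 2) ℂ)) (B : PBond Pc jc) (m : Fin 3 → ℝ),
      (E V B m).foldl (fun U p => update U p.1 (U p.1 * expPt p.2)) (T V) = T (update V B (V B * expPt m)))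
    (hX : ∀ (V : GaugeField Pc jc (Matrix.specialUnitaryGroup (Fin 2) ℂ)) (B : PBond Pc jc) (m : Fin 3 → ℝ) (a₀ : PBond Pf jf),
      (((E V B m).filter (fun p => decide (p.1 = a₀))).map (fun p => ‖p.2‖ / θf)).sum ≤ Xl a₀ B * (‖m‖ / θc))
    (V : GaugeField Pc jc (Matrix.specialUnitaryGroup (Fin 2) ℂ)) (B : PBond Pc jc) (m : Fin 3 → ℝ)
    (hszE : ∀ a ∈ E V B m, ‖a.2‖ / θf ≤ rf)
    (hpre : ∀ i, i < (E V B m).length →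
      PlaqSmall θf (((E V B m).take i).foldl (fun U p => update U p.1 (U p.1 * expPt p.2)) (T V))) :
    |R (T (update V B (V B * expPt m))) - R (T V)| ≤ (∑ a₀ : PBond Pf jf, g a₀ * Xl a₀ B) * (‖m‖ / θc) :=
  firstDiff_pullback_letters_on (PlaqSmall θf) rf
    (fun (U : GaugeField Pf jf (Matrix.specialUnitaryGroup (Fin 2) ℂ)) (b : PBond Pf jf) (u : Fin 3 → ℝ) => update U b (U b * expPt u))
    (fun u : Fin 3 → ℝ => ‖u‖ / θf) R g hg
    (fun (V : GaugeField Pc jc (Matrix.specialUnitaryGroup (Fin 2) ℂ)) (B : PBond Pc jc) (m : Fin 3 → ℝ) => update V B (V B * expPt m))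
    (fun m : Fin 3 → ℝ => ‖m‖ / θc) T E Xl hG hE hX V B m hszE hpre

/-- The same with any first-order coarse letters `xc B ≥ Σ_a g a·Xl a B` (`0 < θc`). [folklore] -/
theorem firstDiff_pullback_window_le {θf θc rf : ℝ} (hθc : 0 < θc)
    {R : GaugeField Pf jf (Matrix.specialUnitaryGroup (Fin 2) ℂ) → ℝ}
    (g : PBond Pf jf → ℝ) (hg : ∀ d, 0 ≤ g d)
    (hG : ∀ (U : GaugeField Pf jf (Matrix.specialUnitaryGroup (Fin 2) ℂ)) (b : PBond Pf jf) (u : Fin 3 → ℝ),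
      PlaqSmall θf U → ‖u‖ / θf ≤ rf → |R (update U b (U b * expPt u)) - R U| ≤ g b * (‖u‖ / θf))
    (T : GaugeField Pc jc (Matrix.specialUnitaryGroup (Fin 2) ℂ) → GaugeField Pf jf (Matrix.specialUnitaryGroup (Fin 2) ℂ))
    (E : GaugeField Pc jc (Matrix.specialUnitaryGroup (Fin 2) ℂ) → PBond Pc jc → (Fin 3 → ℝ) → List (PBond Pf jf × (Fin 3 → ℝ)))
    (Xl : PBond Pf jf → PBond Pc jc → ℝ) (xc : PBond Pc jc → ℝ) (hxc : ∀ B, ∑ a₀ : PBond Pf jf, g a₀ * Xl a₀ B ≤ xc B)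
    (hE : ∀ (V : GaugeField Pc jc (Matrix.specialUnitaryGroup (Fin 2) ℂ)) (B : PBond Pc jc) (m : Fin 3 → ℝ),
      (E V B m).foldl (fun U p => update U p.1 (U p.1 * expPt p.2)) (T V) = T (update V B (V B * expPt m)))
    (hX : ∀ (V : GaugeField Pc jc (Matrix.specialUnitaryGroup (Fin 2) ℂ)) (B : PBond Pc jc) (m : Fin 3 → ℝ) (a₀ : PBond Pf jf),
      (((E V B m).filter (fun p => decide (p.1 = a₀))).map (fun p => ‖p.2‖ / θf)).sum ≤ Xl a₀ B * (‖m‖ / θc))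
    (V : GaugeField Pc jc (Matrix.specialUnitaryGroup (Fin 2) ℂ)) (B : PBond Pc jc) (m : Fin 3 → ℝ)
    (hszE : ∀ a ∈ E V B m, ‖a.2‖ / θf ≤ rf)
    (hpre : ∀ i, i < (E V B m).length →
      PlaqSmall θf (((E V B m).take i).foldl (fun U p => update U p.1 (U p.1 * expPt p.2)) (T V))) :
    |R (T (update V B (V B * expPt m))) - R (T V)| ≤ xc B * (‖m‖ / θc) :=
  (firstDiff_pullback_window g hg hG T E Xl hE hX V B m hszE hpre).trans
    (mul_le_mul_of_nonneg_right (hxc B) (div_nonneg (norm_nonneg m) hθc.le))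

end Summit.QuantumFields.YangMills.Theorems.OrganTangentPullbackSquareOrgan

end
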